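import Literature.Analysis.FluidPDE.ForwardDSSExtension
import HarnessLib

/-!
# Along the DSS scales the large-scale limit of every slice is the blow-up trace — crux
  stmt-NavierStokesRegularity-1404 (`QuantisedSymmetry.PolyhedralDssProfileExists`), line
  polyhedral_cell, stub stub_zoomLimitIsTrace (N27)

Registered stub `stub_zoomLimitIsTrace` (`--supports stmt-NavierStokesRegularity-1404`). Let `V` be
exactly `c`-DSS (`c > 1`) and let `V₀` be the weak limit of the slices `V(t)` as `t ↑ 0` (against
continuous compactly supported test fields `φ`). Then for every `t₀ < 0` and every such `φ`,
`∫ ⟪cᵏ V(t₀, cᵏ x), φ(x)⟫ dx → ∫ ⟪V₀, φ⟫` as `k → ∞`: the Albritton–Barker zooms of any fixed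
slice along the DSS scales `λ = cᵏ` converge weakly to the blow-up trace.

Proof sketch. Iterating `nsRescale c V = V` (`BradshawTsai2019.isDiscretelySelfSimilar_pow`) gives
`cᵏ • V ((cᵏ)² s) (cᵏ • x) = V s x`; at `s = t₀ / (cᵏ)²` this is the pointwise identity
`cᵏ • V t₀ (cᵏ • x) = V (t₀ / (cᵏ)²) x` (`zoomLimitIsTrace_zoom_eq`), so the `k`-th zoom integral
IS the slice integral at time `t₀ / (cᵏ)²`. Since `c² > 1`, `(cᵏ)² = (c²)ᵏ → ∞`, so
`t₀ / (cᵏ)² → 0`, and it is `< 0` for every `k` (`t₀ < 0`); hence `t₀ / (cᵏ)² → 0` within `Iio 0`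
(`zoomLimitIsTrace_tendsto_time`). Compose the weak convergence hypothesis with this sequence.
-/

noncomputable section

-- the summit namespace `…NavierStokesRegularity.NavierStokesRegularity…` is the tree convention (D-0017)
set_option linter.dupNamespace false

namespace Summit.NavierStokesRegularity.NavierStokesRegularity.Theorems.PolyhedralDssProfileExists.PolyhedralCell

open MeasureTheory Set Function Filter Topology
open Literature.Analysis Literature.Analysis.FluidPDE
open scoped InnerProductSpace RealInnerProductSpace

/-! ### The zoom identity along the DSS scales -/

/-- **Zooms of a slice of a DSS field are earlier slices.** For an exactly `c`-DSS field `V`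
(`c ≠ 0`), every `k : ℕ`, time `t₀` and point `x`:
`cᵏ • V t₀ (cᵏ • x) = V (t₀ / (cᵏ)²) x` — the `cᵏ`-self-similarity
`cᵏ • V ((cᵏ)² s) (cᵏ • x) = V s x` read at `s = t₀ / (cᵏ)²`. [folklore] -/
theorem zoomLimitIsTrace_zoom_eq {c : ℝ} (hc : c ≠ 0)
    {V : ℝ → EuclideanSpace ℝ (Fin 3) → EuclideanSpace ℝ (Fin 3)}
    (hdss : IsDiscretelySelfSimilar c V) (k : ℕ) (t₀ : ℝ) (x : EuclideanSpace ℝ (Fin 3)) :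
    (c ^ k) • V t₀ ((c ^ k) • x) = V (t₀ / (c ^ k) ^ 2) x := by
  have hk : IsDiscretelySelfSimilar (c ^ k) V := BradshawTsai2019.isDiscretelySelfSimilar_pow hdss k
  have hck : (c ^ k) ^ 2 ≠ 0 := pow_ne_zero _ (pow_ne_zero _ hc)
  have key := congrFun (congrFun hk (t₀ / (c ^ k) ^ 2)) x
  rw [nsRescale_apply, mul_div_cancel₀ _ hck] at key
  exact key

/-! ### The rescaled times tend to the blow-up time from below -/

/-- **The DSS times `t₀ / (cᵏ)²` tend to `0⁻`.** For `c > 1` and `t₀ < 0` the sequence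
`k ↦ t₀ / (cᵏ)²` tends to `0` within `Iio 0`: `(cᵏ)² = (c²)ᵏ → ∞` (`c² > 1`), so the quotient
tends to `0`, and every term is negative. [folklore] -/
theorem zoomLimitIsTrace_tendsto_time {c : ℝ} (hc : 1 < c) {t₀ : ℝ} (ht₀ : t₀ < 0) :
    Tendsto (fun k : ℕ => t₀ / (c ^ k) ^ 2) atTop (𝓝[<] 0) := by
  have hc0 : 0 < c := one_pos.trans hc
  have hq : 1 < c ^ 2 := by nlinarith
  have hq0 : 0 < c ^ 2 := by positivity
  have h3 : (fun k : ℕ => t₀ / (c ^ k) ^ 2) = fun k : ℕ => t₀ / (c ^ 2) ^ k := by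
    funext k
    rw [← pow_mul, ← pow_mul, mul_comm]
  rw [h3]
  refine tendsto_nhdsWithin_iff.2 ⟨(tendsto_pow_atTop_atTop_of_one_lt hq).const_div_atTop t₀,
    Eventually.of_forall fun k => ?_⟩
  exact div_neg_of_neg_of_pos ht₀ (pow_pos hq0 k)

/-! ### The registered stub -/

/-- **REGISTERED STUB `stub_zoomLimitIsTrace` (N27): along the DSS scales, the large-scale limit of
EVERY slice is the blow-up trace.** Let `V` be exactly `c`-DSS (`c > 1`) and let `V₀` be a field
with `V(t) ⇀ V₀` as `t ↑ 0` (against continuous compactly supported `φ`). Then for every `t₀ < 0`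
and every such `φ`, `∫ ⟪cᵏ V(t₀, cᵏ x), φ(x)⟫ dx → ∫ ⟪V₀, φ⟫` as `k → ∞`. Proof: by the zoom
identity `cᵏ • V t₀ (cᵏ • x) = V (t₀ / (cᵏ)²) x` (`zoomLimitIsTrace_zoom_eq`) the `k`-th integral
is the slice integral at time `t₀ / (cᵏ)²`, and these times tend to `0⁻`
(`zoomLimitIsTrace_tendsto_time`); compose with the weak convergence. Meaning: Albritton–Barker's
zoom limit of any slice of a witness IS the scar `V₀`. [folklore] -/
theorem stub_zoomLimitIsTrace :
    ∀ (V : ℝ → EuclideanSpace ℝ (Fin 3) → EuclideanSpace ℝ (Fin 3)) (c : ℝ)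
      (V₀ : EuclideanSpace ℝ (Fin 3) → EuclideanSpace ℝ (Fin 3)),
      1 < c → IsDiscretelySelfSimilar c V →
      (∀ φ : EuclideanSpace ℝ (Fin 3) → EuclideanSpace ℝ (Fin 3), Continuous φ → HasCompactSupport φ →
        Tendsto (fun t => ∫ x, ⟪V t x, φ x⟫_ℝ) (𝓝[<] 0) (𝓝 (∫ x, ⟪V₀ x, φ x⟫_ℝ))) →
      ∀ t₀ < 0, ∀ φ : EuclideanSpace ℝ (Fin 3) → EuclideanSpace ℝ (Fin 3), Continuous φ → HasCompactSupport φ →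
        Tendsto (fun k : ℕ => ∫ x, ⟪(c ^ k) • V t₀ ((c ^ k) • x), φ x⟫_ℝ) atTop (𝓝 (∫ x, ⟪V₀ x, φ x⟫_ℝ)) := by
  intro V c V₀ hc hdss hweak t₀ ht₀ φ hφ hφc
  have hc0 : c ≠ 0 := (one_pos.trans hc).ne'
  refine Tendsto.congr (fun k => ?_) ((hweak φ hφ hφc).comp (zoomLimitIsTrace_tendsto_time hc ht₀))
  simp only [Function.comp_apply, zoomLimitIsTrace_zoom_eq hc0 hdss]

end Summit.NavierStokesRegularity.NavierStokesRegularity.Theorems.PolyhedralDssProfileExists.PolyhedralCell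

end
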